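import Summits.ValiantsHypothesis.ValiantsHypothesis.Theorems.GrenetZeonDualUnipotentThreeHalvesHeavyTopInstFourSevenBudgetOne

/-!
# `GrenetZeon.DualUnipotentThreeHalves` (stmt-ValiantsHypothesis-24318) — line «radical_split» §8, instance table of R2:
# THE FORMAT `(4, 7)` OF R2 IS FALSE — `¬ HeavyTopInst 4 7` (budget two impossible; assembly)

24318 `HeavyTopLaw` INSTRUMENT (director-valiant g13 R259 (a) / R263; the cut named by the instrument pen val-port-3 g2, 15:14Z:
«the (4,7) far-corner NEGATIVE certificate on the ✓ p635270 template — word certificates of length ≤ 3»; this file val-port-2 g2,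
val-lit merged desk b71 (B) port pool).  Part of the chain `…GrenetZeonDualUnipotentThreeHalvesHeavyTopInstFourSeven{Defs, Toolkit, Blocks, BudgetOne}` (flat helper files) →
`…DualUnipotentThreeHalves/Negative/HeavyTopInstFourSeven` (`¬ HeavyTopInst 4 7`, Negative lane).

* ★★ `no_wordTame_two_NSeven` — no direction space of dimension `> 12` is budget-`2` tame: `Q³ = 0` on the tops of `K`; the
  entries `(Q³)_{i,i+3} = x_i x_{i+1} x_{i+2}` kill a set `Z` of first-superdiagonal coordinates meeting the four windows; the six
  minimal cases `Z = {3,4},{3,5},{3,6},{1,4},{2,4},{2,5}` die by the entries `(Q³)_{i,i+4}`, `(Q³)_{0,5}` — a monomial (third dead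
  coordinate, then a fourth, `dim ≤ 12`), a coordinate times a SPLIT RANK-FOUR QUADRIC (either a fourth coordinate dies, or the
  quadric is totally isotropic on `K` and `dim K ≤ 2 + 10`, ✓ `finrank_le_of_isotropic`), or three dead coordinates SATURATE
  (`K` = the `13`-dimensional coordinate subspace, ✓ `mem_of_forall_apply_eq_zero_of_le`) and `K` contains an explicit top with
  nonzero cube (all second-superdiagonal letters: `(Q³)_{0,6} = y₁y₃y₅ = 1`; or `x₁ + x₂ + z₃`: `(Q³)_{0,5} = 1`).
* ★★★ `not_flagCheap_NSeven : ¬ FlagCheap 4 7 NSeven` (budgets `k ≤ 2` since `(k+1)·4 < dim K ≤ 16`; `k = 0`: injective tops;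
  `k = 1`: ✓ `no_wordTame_one_NSeven`; `k = 2`: the above) and ★★★ `not_heavyTopInst_four_seven : ¬ HeavyTopInst 4 7` — the
  format `(4,7)` of R2 is FALSE although admissible for `C₀ = 1` (`49 < 64`, `format_four_seven`); with ✓ p644208's `format_four` /
  `heavyTopInst_four_of_le_five` the `n = 4` column for `C₀ = 1` reads `m ≤ 5` TRUE · `m = 6` OPEN · `m = 7` FALSE.  As at `(3,5)`
  (✓ `not_heavyTopInst_three_five`) this is a TINY-`n` ARTEFACT of the constants, NOT a refutation of `HeavyTopLaw`
  (`n₀ ≥ 5` or `C₀ ≥ 2` discards it); it confirms the instrument's far-corner prediction (INSTANCES.md v1 (5)) at its first format.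

Honest framing.  Helper lemmas for ONE tiny format of R2's instance table (`--supports stmt-ValiantsHypothesis-24318 --as helper`);
nothing here asserts or refutes R2 `HeavyTopLaw` (take `n₀ ≥ 5` or `C₀ ≥ 2` and `(4,7)` is discarded), S3b, the crux
`DualUnipotentThreeHalves`, rung 8062 or `VP ≠ VNP` — all OPEN / NOT proved.
[this line's workfile §8; port-3 g2 `Cruxes/DualUnipotentThreeHalves/INSTANCES.md` v1 (5); ✓ `…Negative.HeavyTopInstThreeFive`; ✓ `…WordFlagPencil`]
-/

-- `Summit.ValiantsHypothesis.ValiantsHypothesis.…` repeats a component (D-0017 layout); `dupNamespace` would flag the mandated name.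
set_option linter.dupNamespace false
set_option autoImplicit false

noncomputable section

namespace Summit.ValiantsHypothesis.ValiantsHypothesis.Theorems.GrenetZeon.RadicalSplit

open MvPolynomial Matrix
open scoped BigOperators
open Summit.ValiantsHypothesis.ValiantsHypothesis.Cruxes.TwoDimCoefficients.DimTwoCases (AffMat IsAffine)

/-- **Budget `2` is impossible for the far-corner `(4,7)` pencil**: no direction space `K` of dimension `> 12` has every pair
`(topSeven x, topSeven v)`, `v ∈ K`, word-tame with budget `2`.  Budget `2` forces `Q³ = 0` for every top `Q = topSeven v`,
`v ∈ K`; the entries `(Q³)_{i,i+3} = x_i x_{i+1} x_{i+2}` of the first superdiagonal kill a set `Z` of first-superdiagonal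
coordinates meeting the four windows `{1,2,3}, {2,3,4}, {3,4,5}, {4,5,6}`; the six minimal cases `Z = {3,4}, {3,5}, {3,6}, {1,4},
{2,4}, {2,5}` die by the entries `(Q³)_{i,i+4}`, `(Q³)_{i,i+5}` — a monomial, a coordinate times a split rank-four quadric (then
either a fourth coordinate dies, `dim K ≤ 12`, or the quadric is totally isotropic on `K`, `dim K ≤ 2 + 10`), or — with three
dead coordinates — `K` is the whole `13`-dimensional coordinate subspace and contains an explicit top with nonzero cube. [this file] -/
theorem no_wordTame_two_NSeven (K : Submodule ℂ (Fin 4 × Fin 4 → ℂ)) (hdim : 12 < Module.finrank ℂ K)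
    (hW : ∀ x v : Fin 4 × Fin 4 → ℂ, v ∈ K → WordTame 4 2 (topSeven x) (topSeven v)) : False := by
  classical
  have hcard : Fintype.card (Fin 4 × Fin 4) = 16 := by simp
  -- cubes of tops vanish on K
  have hcube : ∀ v ∈ K, topSeven v * topSeven v * topSeven v = 0 := fun v hv => by
    have h := pow_eq_zero_of_wordTame (by norm_num) _ _ (hW 0 v hv)
    simpa [pow_succ, Matrix.mul_assoc] using h
  -- the cube entries we use
  have e03 : ∀ v ∈ K, v (0,0) * v (1,0) * v (2,0) = 0 := fun v hv => by
    have h := congr_fun (congr_fun (hcube v hv) 0) 3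
    simp [topSeven, Matrix.mul_apply, Fin.sum_univ_seven, -mul_eq_zero] at h
    linear_combination h
  have e14 : ∀ v ∈ K, v (1,0) * v (2,0) * v (3,0) = 0 := fun v hv => by
    have h := congr_fun (congr_fun (hcube v hv) 1) 4
    simp [topSeven, Matrix.mul_apply, Fin.sum_univ_seven, -mul_eq_zero] at h
    linear_combination h
  have e25 : ∀ v ∈ K, v (1,3) * v (2,0) * v (3,0) = 0 := fun v hv => by
    have h := congr_fun (congr_fun (hcube v hv) 2) 5
    simp [topSeven, Matrix.mul_apply, Fin.sum_univ_seven, -mul_eq_zero] at h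
    linear_combination h
  have e36 : ∀ v ∈ K, v (1,3) * v (3,0) * v (3,3) = 0 := fun v hv => by
    have h := congr_fun (congr_fun (hcube v hv) 3) 6
    simp [topSeven, Matrix.mul_apply, Fin.sum_univ_seven, -mul_eq_zero] at h
    linear_combination h
  have e04 : ∀ v ∈ K, v (0,0) * v (1,0) * v (2,1) + v (0,0) * v (1,1) * v (3,0) + v (0,1) * v (2,0) * v (3,0) = 0 :=
    fun v hv => by
    have h := congr_fun (congr_fun (hcube v hv) 0) 4
    simp [topSeven, Matrix.mul_apply, Fin.sum_univ_seven, -mul_eq_zero] at h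
    linear_combination h
  have e15 : ∀ v ∈ K, v (1,0) * v (1,3) * v (2,1) + v (1,0) * v (2,0) * v (3,1) + v (1,1) * v (1,3) * v (3,0) = 0 :=
    fun v hv => by
    have h := congr_fun (congr_fun (hcube v hv) 1) 5
    simp [topSeven, Matrix.mul_apply, Fin.sum_univ_seven, -mul_eq_zero] at h
    linear_combination h
  have e26 : ∀ v ∈ K, v (1,3) * v (2,1) * v (3,3) + v (2,0) * v (2,3) * v (3,0) + v (2,0) * v (3,1) * v (3,3) = 0 :=
    fun v hv => by
    have h := congr_fun (congr_fun (hcube v hv) 2) 6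
    simp [topSeven, Matrix.mul_apply, Fin.sum_univ_seven, -mul_eq_zero] at h
    linear_combination h
  have e05 : ∀ v ∈ K, v (0,0) * v (1,0) * v (2,2) + v (0,0) * v (1,1) * v (3,1) + v (0,0) * v (1,2) * v (1,3) +
      v (0,1) * v (1,3) * v (2,1) + v (0,1) * v (2,0) * v (3,1) + v (0,2) * v (1,3) * v (3,0) = 0 := fun v hv => by
    have h := congr_fun (congr_fun (hcube v hv) 0) 5
    simp [topSeven, Matrix.mul_apply, Fin.sum_univ_seven, -mul_eq_zero] at h
    linear_combination h
  -- closers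
  have close4 : ∀ a b c d : Fin 4 × Fin 4, [a, b, c, d].Nodup → (∀ v ∈ K, v a = 0) → (∀ v ∈ K, v b = 0) →
      (∀ v ∈ K, v c = 0) → (∀ v ∈ K, v d = 0) → False := by
    intro a b c d hnd ha hb hc hd
    have hle := finrank_add_length_le_of_forall_apply_eq_zero K [a, b, c, d] hnd (by
      intro v hv x hx
      simp only [List.mem_cons, List.mem_nil_iff, or_false] at hx
      rcases hx with rfl | rfl | rfl | rfl
      · exact ha v hv
      · exact hb v hv
      · exact hc v hv
      · exact hd v hv)
    simp only [List.length_cons, List.length_nil] at hle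
    omega
  have closeIso : ∀ b c d e x y : Fin 4 × Fin 4, [b, c, d, e, x, y].Nodup →
      (∀ v ∈ K, v b * v c + v d * v e = 0) → (∀ v ∈ K, v x = 0) → (∀ v ∈ K, v y = 0) → False := by
    intro b c d e x y hnd hq hx hy
    have hle := finrank_le_of_isotropic K b c d e [x, y] hnd hq (by
      intro v hv z hz
      simp only [List.mem_cons, List.mem_nil_iff, or_false] at hz
      rcases hz with rfl | rfl
      · exact hx v hv
      · exact hy v hv)
    simp only [List.length_cons, List.length_nil] at hle
    omega
  have closeWit : ∀ a b c : Fin 4 × Fin 4, [a, b, c].Nodup → (∀ v ∈ K, v a = 0) → (∀ v ∈ K, v b = 0) →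
      (∀ v ∈ K, v c = 0) → ∀ u : Fin 4 × Fin 4 → ℂ, u a = 0 → u b = 0 → u c = 0 →
      topSeven u * topSeven u * topSeven u ≠ 0 → False := by
    intro a b c hnd ha hb hc u hua hub huc hu
    refine hu (hcube u (mem_of_forall_apply_eq_zero_of_le K [a, b, c] hnd ?_ (by simp; omega) u ?_))
    · intro v hv x hx
      simp only [List.mem_cons, List.mem_nil_iff, or_false] at hx
      rcases hx with rfl | rfl | rfl
      · exact ha v hv
      · exact hb v hv
      · exact hc v hv
    · intro x hx
      simp only [List.mem_cons, List.mem_nil_iff, or_false] at hx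
      rcases hx with rfl | rfl | rfl
      · exact hua
      · exact hub
      · exact huc
  -- the two explicit tops with nonzero cube: all second-superdiagonal letters, and `x₁ + x₂ + z₃`
  obtain ⟨uY, huYdef⟩ : ∃ uY : Fin 4 × Fin 4 → ℂ,
      uY = fun p => if p = (0,1) ∨ p = (1,1) ∨ p = (2,1) ∨ p = (3,1) ∨ p = (2,3) then 1 else 0 := ⟨_, rfl⟩
  have huY : topSeven uY * topSeven uY * topSeven uY ≠ 0 := by
    intro h
    have h06 := congr_fun (congr_fun h 0) 6
    simp [topSeven, huYdef, Matrix.mul_apply, Fin.sum_univ_seven] at h06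
  obtain ⟨uX, huXdef⟩ : ∃ uX : Fin 4 × Fin 4 → ℂ,
      uX = fun p => if p = (0,0) ∨ p = (1,0) ∨ p = (2,2) then 1 else 0 := ⟨_, rfl⟩
  have huX : topSeven uX * topSeven uX * topSeven uX ≠ 0 := by
    intro h
    have h05 := congr_fun (congr_fun h 0) 5
    simp [topSeven, huXdef, Matrix.mul_apply, Fin.sum_univ_seven] at h05
  -- the four windows of the first superdiagonal
  have w1 := forall_apply_eq_zero_or₃ K (0,0) (1,0) (2,0) e03
  have w2 := forall_apply_eq_zero_or₃ K (1,0) (2,0) (3,0) e14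
  have w3 := forall_apply_eq_zero_or₃ K (1,3) (2,0) (3,0) e25
  have w4 := forall_apply_eq_zero_or₃ K (1,3) (3,0) (3,3) e36
  -- Case analysis on the dead set Z
  -- CASE {3,4}: x₃ = v(2,0), x₄ = v(3,0)
  have case34 : (∀ v ∈ K, v (2,0) = 0) → (∀ v ∈ K, v (3,0) = 0) → False := by
    intro dx3 dx4
    have m : ∀ v ∈ K, v (0,0) * v (1,0) * v (2,1) = 0 := fun v hv => by
      have h := e04 v hv
      rw [dx3 v hv, dx4 v hv] at h
      linear_combination h
    rcases forall_apply_eq_zero_or₃ K (0,0) (1,0) (2,1) m with dx1 | dx2 | dy3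
    · have m2 : ∀ v ∈ K, v (1,0) * v (1,3) * v (2,1) = 0 := fun v hv => by
        have h := e15 v hv
        rw [dx3 v hv, dx4 v hv] at h
        linear_combination h
      rcases forall_apply_eq_zero_or₃ K (1,0) (1,3) (2,1) m2 with dx2 | dx5 | dy3
      · exact close4 (2,0) (3,0) (0,0) (1,0) (by decide) dx3 dx4 dx1 dx2
      · exact close4 (2,0) (3,0) (0,0) (1,3) (by decide) dx3 dx4 dx1 dx5
      · exact close4 (2,0) (3,0) (0,0) (2,1) (by decide) dx3 dx4 dx1 dy3
    · have m2 : ∀ v ∈ K, v (1,3) * v (2,1) * v (3,3) = 0 := fun v hv => by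
        have h := e26 v hv
        rw [dx3 v hv, dx4 v hv] at h
        linear_combination h
      rcases forall_apply_eq_zero_or₃ K (1,3) (2,1) (3,3) m2 with dx5 | dy3 | dx6
      · exact close4 (2,0) (3,0) (1,0) (1,3) (by decide) dx3 dx4 dx2 dx5
      · exact close4 (2,0) (3,0) (1,0) (2,1) (by decide) dx3 dx4 dx2 dy3
      · exact close4 (2,0) (3,0) (1,0) (3,3) (by decide) dx3 dx4 dx2 dx6
    · exact closeWit (2,0) (3,0) (2,1) (by decide) dx3 dx4 dy3 uX
        (by simp [huXdef]) (by simp [huXdef]) (by simp [huXdef]) huX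
  -- CASE {3,5}: x₃ = v(2,0), x₅ = v(1,3)
  have case35 : (∀ v ∈ K, v (2,0) = 0) → (∀ v ∈ K, v (1,3) = 0) → False := by
    intro dx3 dx5
    have m : ∀ v ∈ K, v (0,0) * (v (1,0) * v (2,1) + v (1,1) * v (3,0)) = 0 := fun v hv => by
      have h := e04 v hv
      rw [dx3 v hv] at h
      linear_combination h
    rcases forall_apply_eq_zero_or_quad K (0,0) (1,0) (2,1) (1,1) (3,0) m with dx1 | hq
    · exact closeWit (2,0) (1,3) (0,0) (by decide) dx3 dx5 dx1 uY
        (by simp [huYdef]) (by simp [huYdef]) (by simp [huYdef]) huY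
    · exact closeIso (1,0) (2,1) (1,1) (3,0) (2,0) (1,3) (by decide) hq dx3 dx5
  -- CASE {3,6}: x₃ = v(2,0), x₆ = v(3,3)
  have case36 : (∀ v ∈ K, v (2,0) = 0) → (∀ v ∈ K, v (3,3) = 0) → False := by
    intro dx3 dx6
    have m : ∀ v ∈ K, v (0,0) * (v (1,0) * v (2,1) + v (1,1) * v (3,0)) = 0 := fun v hv => by
      have h := e04 v hv
      rw [dx3 v hv] at h
      linear_combination h
    have m2 : ∀ v ∈ K, v (1,3) * (v (1,0) * v (2,1) + v (1,1) * v (3,0)) = 0 := fun v hv => by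
      have h := e15 v hv
      rw [dx3 v hv] at h
      linear_combination h
    rcases forall_apply_eq_zero_or_quad K (0,0) (1,0) (2,1) (1,1) (3,0) m with dx1 | hq
    · rcases forall_apply_eq_zero_or_quad K (1,3) (1,0) (2,1) (1,1) (3,0) m2 with dx5 | hq
      · exact close4 (2,0) (3,3) (0,0) (1,3) (by decide) dx3 dx6 dx1 dx5
      · exact closeIso (1,0) (2,1) (1,1) (3,0) (2,0) (3,3) (by decide) hq dx3 dx6
    · exact closeIso (1,0) (2,1) (1,1) (3,0) (2,0) (3,3) (by decide) hq dx3 dx6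
  -- CASE {2,4}: x₂ = v(1,0), x₄ = v(3,0)
  have case24 : (∀ v ∈ K, v (1,0) = 0) → (∀ v ∈ K, v (3,0) = 0) → False := by
    intro dx2 dx4
    have m : ∀ v ∈ K, v (3,3) * (v (1,3) * v (2,1) + v (2,0) * v (3,1)) = 0 := fun v hv => by
      have h := e26 v hv
      rw [dx4 v hv] at h
      linear_combination h
    rcases forall_apply_eq_zero_or_quad K (3,3) (1,3) (2,1) (2,0) (3,1) m with dx6 | hq
    · exact closeWit (1,0) (3,0) (3,3) (by decide) dx2 dx4 dx6 uY
        (by simp [huYdef]) (by simp [huYdef]) (by simp [huYdef]) huY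
    · exact closeIso (1,3) (2,1) (2,0) (3,1) (1,0) (3,0) (by decide) hq dx2 dx4
  -- CASE {2,5}: x₂ = v(1,0), x₅ = v(1,3)
  have case25 : (∀ v ∈ K, v (1,0) = 0) → (∀ v ∈ K, v (1,3) = 0) → False := by
    intro dx2 dx5
    have m : ∀ v ∈ K, v (3,0) * (v (0,0) * v (1,1) + v (0,1) * v (2,0)) = 0 := fun v hv => by
      have h := e04 v hv
      rw [dx2 v hv] at h
      linear_combination h
    have m2 : ∀ v ∈ K, v (3,1) * (v (0,0) * v (1,1) + v (0,1) * v (2,0)) = 0 := fun v hv => by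
      have h := e05 v hv
      rw [dx2 v hv, dx5 v hv] at h
      linear_combination h
    rcases forall_apply_eq_zero_or_quad K (3,0) (0,0) (1,1) (0,1) (2,0) m with dx4 | hq
    · rcases forall_apply_eq_zero_or_quad K (3,1) (0,0) (1,1) (0,1) (2,0) m2 with dy4 | hq
      · exact close4 (1,0) (1,3) (3,0) (3,1) (by decide) dx2 dx5 dx4 dy4
      · exact closeIso (0,0) (1,1) (0,1) (2,0) (1,0) (1,3) (by decide) hq dx2 dx5
    · exact closeIso (0,0) (1,1) (0,1) (2,0) (1,0) (1,3) (by decide) hq dx2 dx5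
  -- CASE {1,4}: x₁ = v(0,0), x₄ = v(3,0)
  have case14 : (∀ v ∈ K, v (0,0) = 0) → (∀ v ∈ K, v (3,0) = 0) → False := by
    intro dx1 dx4
    have m : ∀ v ∈ K, v (1,0) * (v (1,3) * v (2,1) + v (2,0) * v (3,1)) = 0 := fun v hv => by
      have h := e15 v hv
      rw [dx4 v hv] at h
      linear_combination h
    have m2 : ∀ v ∈ K, v (3,3) * (v (1,3) * v (2,1) + v (2,0) * v (3,1)) = 0 := fun v hv => by
      have h := e26 v hv
      rw [dx4 v hv] at h
      linear_combination h
    rcases forall_apply_eq_zero_or_quad K (1,0) (1,3) (2,1) (2,0) (3,1) m with dx2 | hq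
    · rcases forall_apply_eq_zero_or_quad K (3,3) (1,3) (2,1) (2,0) (3,1) m2 with dx6 | hq
      · exact close4 (0,0) (3,0) (1,0) (3,3) (by decide) dx1 dx4 dx2 dx6
      · exact closeIso (1,3) (2,1) (2,0) (3,1) (0,0) (3,0) (by decide) hq dx1 dx4
    · exact closeIso (1,3) (2,1) (2,0) (3,1) (0,0) (3,0) (by decide) hq dx1 dx4
  -- the window tree
  by_cases dx3 : ∀ v ∈ K, v (2,0) = 0
  · rcases w4 with dx5 | dx4 | dx6
    · exact case35 dx3 dx5
    · exact case34 dx3 dx4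
    · exact case36 dx3 dx6
  · rcases w2 with dx2 | h | dx4
    · by_cases dx4 : ∀ v ∈ K, v (3,0) = 0
      · exact case24 dx2 dx4
      · rcases w3 with dx5 | h | h
        · exact case25 dx2 dx5
        · exact dx3 h
        · exact dx4 h
    · exact dx3 h
    · rcases w1 with dx1 | dx2 | h
      · exact case14 dx1 dx4
      · exact case24 dx2 dx4
      · exact dx3 h

/-- **`NSeven` is not flag-cheap at `n = 4`.** [this file] -/
theorem not_flagCheap_NSeven : ¬ FlagCheap 4 7 NSeven := by
  classical
  rw [flagCheap_iff_wordTame NSeven isAffine_NSeven]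
  rintro ⟨K, k, hdim, hW⟩
  have hV : Module.finrank ℂ (Fin 4 × Fin 4 → ℂ) = 16 := by simp [Module.finrank_fintype_fun_eq_card]
  have hKle : Module.finrank ℂ K ≤ 16 := by
    have h1 := Submodule.finrank_le K
    omega
  have hk2 : k ≤ 2 := by
    by_contra hk
    have : 4 * 4 ≤ (k + 1) * 4 := Nat.mul_le_mul_right 4 (by omega)
    omega
  have hW' : ∀ x v : Fin 4 × Fin 4 → ℂ, v ∈ K → WordTame 4 k (topSeven x) (topSeven v) := fun x v hv => by
    have h := hW x v hv
    rwa [NSeven_map_eval, linPart_NSeven] at h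
  interval_cases k
  · -- budget 0: tops vanish on K, so K = ⊥
    have hK : K = ⊥ := by
      rw [Submodule.eq_bot_iff]
      intro v hv
      have h0 : topSeven v = 0 := by simpa using pow_eq_zero_of_wordTame (by norm_num) _ _ (hW' 0 v hv)
      exact eq_zero_of_topSeven_eq_zero v h0
    rw [hK, finrank_bot] at hdim
    omega
  · exact no_wordTame_one_NSeven K (by omega) hW'
  · exact no_wordTame_two_NSeven K (by omega) hW'

/-- **The format `(4, 7)` of R2 is FALSE** (admissible for `C₀ = 1`: `49 < 64`; the heavy-top hypothesis is automatic at `n = 4`: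
`dim K ≤ 16 ≤ 16·7·2 + 64`).  NOT a refutation of `HeavyTopLaw` (take `n₀ ≥ 5` or `C₀ ≥ 2`): a kernel-checked data point of the
instance table — `C₀ = 1 ∧ n₀ ≤ 4` is not an admissible parameter choice for R2, and the far-corner pencil predicted expensive by
the instrument (port-3 g2, INSTANCES.md v1 (5)) IS expensive at `(4,7)`. [this file] -/
theorem not_heavyTopInst_four_seven : ¬ HeavyTopInst 4 7 := by
  intro h
  have hV : Module.finrank ℂ (Fin 4 × Fin 4 → ℂ) = 16 := by simp [Module.finrank_fintype_fun_eq_card]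
  refine not_flagCheap_NSeven (h NSeven isAffine_NSeven NSeven_pow fun K _ => ?_)
  have h1 := Submodule.finrank_le K
  omega

/-- Format bookkeeping: `(4,7)` is admissible for `C₀ = 1` (`49 < 64`), `(4,8)` is not; with ✓ `format_four` / ✓ `heavyTopInst_four_of_le_five`
the `n = 4` column for `C₀ = 1` reads: `m ≤ 5` TRUE, `m = 6` OPEN, `m = 7` FALSE. -/
theorem format_four_seven : 1 * 7 ^ 2 < 4 ^ 3 ∧ ¬ (1 * 8 ^ 2 < 4 ^ 3) := by decide

end Summit.ValiantsHypothesis.ValiantsHypothesis.Theorems.GrenetZeon.RadicalSplit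

end
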